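import Summits.ResolutionOfSingularities.ResolutionOfSingularities.Theorems.WeightedInvariantLocalWeightedDropTrackCSurfaceGermsWonB
import Summits.ResolutionOfSingularities.ResolutionOfSingularities.Theorems.WeightedInvariantLocalWeightedDropSeparableTerminalDoublePointsAux
import Summits.ResolutionOfSingularities.ResolutionOfSingularities.Theorems.WeightedInvariantLocalWeightedDropWildUnaryConeMonic
import Summits.ResolutionOfSingularities.ResolutionOfSingularities.Theorems.WeightedInvariantLocalWeightedDropWildTerminalCalculus

/-!
# TRACK C modulo F-32bR: the five `N = 3` class stubs of the engine skeleton as INSTANCES, and the banked concluder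

[OURS · L1 W4.3 · chain w43, engine crux `LocalWeightedDrop` stmt-ResolutionOfSingularities-8899, registered skeleton v28
(`L/res-L1-w43-lead-1/LocalWeightedDrop_v28_plan1.lean`, sha16 b8b73808bd522080); res-type-088, ORDER (o1) of CHAIN w43 v4.4 as
AMENDED by v4.4.1 (iii): keyed to the CORRECTED Cossart–Jannsen–Saito fact F-32bR
`Literature.AlgebraicGeometry.Resolution.CossartJannsenSaito2020EmbeddedSequenceB`, never to the superseded F-32b]
NOT a statement of any manuscript; the game (`CobordantGame.Won`) is the programme's own.  This file closes NOTHING by name: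
it records, as kernel-checked implications, that the corrected CJS sequence fact makes the five `N = 3` class stubs of the
registered engine skeleton consequences of `TrackC.surfaceGermsWon_of_CJSSequenceB` (`…TrackCSurfaceGermsWonB`, p497328: every
singular surface germ over an algebraically closed field of prime characteristic is won, modulo F-32bR).

* `isSingular_pureForm` — `y^d + A₀(x₀,x₁)` with `ord A₀ ≥ d ≥ 2` is a singular germ (order exactly `d`,
  `WildTerminal.order_X_pow_add_rename_eq`).
* `stub_charTwoInseparableReductionWon_of_CJSB` (S2iM), `stub_charTwoSeparablePureWon_of_CJSB` (S2sP),
  `stub_charTwoSeparableReductionWon_of_CJSB` (S2sM), `stub_wildPurelyInseparableReductionWon_of_CJSB` (S3πM),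
  `stub_wildMonicSurfaceReductionWon_of_CJSB` (S3ρ) — `CossartJannsenSaito2020EmbeddedSequenceB.{0} →` the v28 stub statement
  VERBATIM; each proof = p497328 applied to the displayed germ, whose singularity is `isSingular_pureForm` /
  `SepTerminalDoublePoint.isSingular_dp1` / `WildUnaryConeMonic.isSingular_monicForm` (all the stubs' other hypotheses are unused).
* The banked concluder `localWeightedDrop_of_CJSB_of_residuals` (`CossartJannsenSaito2020EmbeddedSequenceB.{0} → W4 → T″ →
  LocalWeightedDrop`) lives in the sibling `…TrackCLocalWeightedDropOfCJSB` (it must import the route file; this file stays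
  route-independent).  The by-name status of the skeleton (7 stubs) is unchanged by either file.
-/

noncomputable section

open Literature.AlgebraicGeometry.Resolution

set_option linter.dupNamespace false -- mandated namespace of this single-conjunct summit

namespace Summit.ResolutionOfSingularities.ResolutionOfSingularities.Theorems.TrackC

/-- **The pure monic form `y^d + A₀(x₀,x₁)` with `ord A₀ ≥ d ≥ 2` is a singular germ** (its order is exactly `d`).
[OURS · folklore] -/
theorem isSingular_pureForm (k : Type) [Field k] {d : ℕ} (hd : 2 ≤ d) (A₀ : MvPowerSeries (Fin 2) k)
    (hA₀ : (d : ℕ∞) ≤ A₀.order) :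
    CobordantGame.IsSingular k (MvPowerSeries.X (Fin.last 2) ^ d +
      MvPowerSeries.rename (Fin.succAboveEmb (Fin.last 2)) A₀) := by
  have hord := WildTerminal.order_X_pow_add_rename_eq (k := k) (m := 2) (d := d) (by omega) A₀ hA₀
  refine ⟨fun h => ?_, (FormalCoordChange.two_le_order_iff _).mp ?_⟩
  · rw [h, MvPowerSeries.order_zero] at hord
    exact absurd hord (by simp)
  · rw [hord]
    exact_mod_cast hd

/-- The constant coefficient of a series of positive order vanishes. [OURS · folklore] -/
theorem constantCoeff_eq_zero_of_order_pos {k : Type} [Field k] {σ : Type} {g : MvPowerSeries σ k}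
    (hg : 0 < g.order) : MvPowerSeries.constantCoeff g = 0 := by
  rw [← MvPowerSeries.coeff_zero_eq_constantCoeff_apply]
  exact MvPowerSeries.coeff_of_lt_order (by simpa using hg)

/-- **S2iM as an instance of Track C modulo F-32bR** — the registered stub `stub_charTwoInseparableReductionWon` of skeleton v28
(statement VERBATIM) follows from `CossartJannsenSaito2020EmbeddedSequenceB`: the displayed germ `y² + A₀`, `ord A₀ > 2`, is a
singular surface germ, won by `surfaceGermsWon_of_CJSSequenceB`. [OURS · L1 W4.3] -/
theorem stub_charTwoInseparableReductionWon_of_CJSB (hCJS : CossartJannsenSaito2020EmbeddedSequenceB.{0}) :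
    ∀ (k : Type) [Field k] [CharP k 2] [IsAlgClosed k],
      (∀ m : ℕ, m < 3 → ∀ g : MvPowerSeries (Fin m) k,
        CobordantGame.IsSingular k g → CobordantGame.Won k m g) →
      (∀ (A₀ : MvPowerSeries (Fin 2) k), (2 : ℕ∞) < A₀.order →
        ((∃ (r s : ℕ) (U : MvPowerSeries (Fin 2) k), MvPowerSeries.constantCoeff U ≠ 0 ∧ ¬ (2 ∣ r ∧ 2 ∣ s) ∧
            A₀ = MvPowerSeries.X (0 : Fin 2) ^ r * MvPowerSeries.X (1 : Fin 2) ^ s * U) ∨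
          (∃ (i : Fin 2) (m : ℕ) (g : MvPowerSeries (Fin 2) k), 0 < m ∧ g.order = 1 ∧
            A₀ = MvPowerSeries.X i ^ (2 * m) * g)) →
        CobordantGame.Won k 3 (MvPowerSeries.X (Fin.last 2) ^ 2 +
          MvPowerSeries.rename (Fin.succAboveEmb (Fin.last 2)) A₀)) →
      ∀ (A₀ : MvPowerSeries (Fin 2) k), (2 : ℕ∞) < A₀.order →
        CobordantGame.Won k 3 (MvPowerSeries.X (Fin.last 2) ^ 2 +
          MvPowerSeries.rename (Fin.succAboveEmb (Fin.last 2)) A₀) := by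
  intro k _ _ _ _ _ A₀ hA₀
  exact surfaceGermsWon_of_CJSSequenceB hCJS 2 Nat.prime_two k _ (isSingular_pureForm k le_rfl A₀ hA₀.le)

/-- **S2sP as an instance of Track C modulo F-32bR** — the registered stub `stub_charTwoSeparablePureWon` of skeleton v28 (statement
VERBATIM) follows from `CossartJannsenSaito2020EmbeddedSequenceB`: `y² + x₀^a x₁^b · y + A₀` with `a + b ≥ 2`, `ord A₀ > 2` is a
singular surface germ (`SepTerminalDoublePoint.isSingular_dp1`). [OURS · L1 W4.3] -/
theorem stub_charTwoSeparablePureWon_of_CJSB (hCJS : CossartJannsenSaito2020EmbeddedSequenceB.{0}) :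
    ∀ (k : Type) [Field k] [CharP k 2] [IsAlgClosed k],
      (∀ m : ℕ, m < 3 → ∀ g : MvPowerSeries (Fin m) k,
        CobordantGame.IsSingular k g → CobordantGame.Won k m g) →
      ∀ (A₀ : MvPowerSeries (Fin 2) k) (a b : ℕ), (2 : ℕ∞) < A₀.order → 2 ≤ a + b →
        CobordantGame.Won k 3 (MvPowerSeries.X (Fin.last 2) ^ 2 +
          (MvPowerSeries.rename (Fin.succAboveEmb (Fin.last 2)) A₀ +
            MvPowerSeries.rename (Fin.succAboveEmb (Fin.last 2)) (MvPowerSeries.X 0 ^ a * MvPowerSeries.X 1 ^ b) *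
              MvPowerSeries.X (Fin.last 2))) := by
  intro k _ _ _ _ A₀ a b hA₀ hab
  obtain ⟨h0, h1⟩ := (FormalCoordChange.two_le_order_iff A₀).mp hA₀.le
  have hA₁ : MvPowerSeries.constantCoeff
      (MvPowerSeries.X (0 : Fin 2) ^ a * MvPowerSeries.X (1 : Fin 2) ^ b : MvPowerSeries (Fin 2) k) = 0 := by
    rw [map_mul, map_pow, map_pow, MvPowerSeries.constantCoeff_X, MvPowerSeries.constantCoeff_X]
    rcases Nat.eq_zero_or_pos a with ha | ha
    · subst ha
      rw [pow_zero, one_mul, zero_pow (by omega)]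
    · rw [zero_pow ha.ne', zero_mul]
  exact surfaceGermsWon_of_CJSSequenceB hCJS 2 Nat.prime_two k _ (SepTerminalDoublePoint.isSingular_dp1 h0 h1 hA₁)

/-- **S2sM as an instance of Track C modulo F-32bR** — the registered-name theorem `stub_charTwoSeparableReductionWon` of skeleton v28
(statement VERBATIM) follows from `CossartJannsenSaito2020EmbeddedSequenceB`: `y² + A₁ y + A₀` with `ord A₀ > 2`, `ord A₁ > 1` is a
singular surface germ (`SepTerminalDoublePoint.isSingular_dp1`). [OURS · L1 W4.3] -/
theorem stub_charTwoSeparableReductionWon_of_CJSB (hCJS : CossartJannsenSaito2020EmbeddedSequenceB.{0}) :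
    ∀ (k : Type) [Field k] [CharP k 2] [IsAlgClosed k],
      (∀ m : ℕ, m < 3 → ∀ g : MvPowerSeries (Fin m) k,
        CobordantGame.IsSingular k g → CobordantGame.Won k m g) →
      (∀ (A₀ A₁ : MvPowerSeries (Fin 2) k), (2 : ℕ∞) < A₀.order → (1 : ℕ∞) < A₁.order → A₁ ≠ 0 →
        ((∃ (r s : ℕ) (U B : MvPowerSeries (Fin 2) k), MvPowerSeries.constantCoeff U ≠ 0 ∧ ¬ (2 ∣ r ∧ 2 ∣ s) ∧
            A₀ = MvPowerSeries.X (0 : Fin 2) ^ r * MvPowerSeries.X (1 : Fin 2) ^ s * U ∧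
            A₁ = MvPowerSeries.X (0 : Fin 2) ^ (r / 2) * MvPowerSeries.X (1 : Fin 2) ^ (s / 2) * B) ∨
          (∃ (r s : ℕ) (V W : MvPowerSeries (Fin 2) k), MvPowerSeries.constantCoeff V ≠ 0 ∧
            A₁ = MvPowerSeries.X (0 : Fin 2) ^ r * MvPowerSeries.X (1 : Fin 2) ^ s * V ∧
            A₀ = MvPowerSeries.X (0 : Fin 2) ^ (2 * r) * MvPowerSeries.X (1 : Fin 2) ^ (2 * s) * W) ∨
          (∃ (i : Fin 2) (m : ℕ) (g B : MvPowerSeries (Fin 2) k), 0 < m ∧ g.order = 1 ∧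
            A₀ = MvPowerSeries.X i ^ (2 * m) * g ∧ A₁ = MvPowerSeries.X i ^ m * B)) →
        CobordantGame.Won k 3 (MvPowerSeries.X (Fin.last 2) ^ 2 +
          (MvPowerSeries.rename (Fin.succAboveEmb (Fin.last 2)) A₀ +
            MvPowerSeries.rename (Fin.succAboveEmb (Fin.last 2)) A₁ * MvPowerSeries.X (Fin.last 2)))) →
      ∀ (A₀ A₁ : MvPowerSeries (Fin 2) k), (2 : ℕ∞) < A₀.order → (1 : ℕ∞) < A₁.order → A₁ ≠ 0 →
        CobordantGame.Won k 3 (MvPowerSeries.X (Fin.last 2) ^ 2 +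
          (MvPowerSeries.rename (Fin.succAboveEmb (Fin.last 2)) A₀ +
            MvPowerSeries.rename (Fin.succAboveEmb (Fin.last 2)) A₁ * MvPowerSeries.X (Fin.last 2))) := by
  intro k _ _ _ _ _ A₀ A₁ hA₀ hA₁ _
  obtain ⟨h0, h1⟩ := (FormalCoordChange.two_le_order_iff A₀).mp hA₀.le
  have hA₁0 : MvPowerSeries.constantCoeff A₁ = 0 :=
    constantCoeff_eq_zero_of_order_pos (lt_trans zero_lt_one hA₁)
  exact surfaceGermsWon_of_CJSSequenceB hCJS 2 Nat.prime_two k _ (SepTerminalDoublePoint.isSingular_dp1 h0 h1 hA₁0)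

/-- **S3πM as an instance of Track C modulo F-32bR** — the registered stub `stub_wildPurelyInseparableReductionWon` of skeleton v28
(statement VERBATIM) follows from `CossartJannsenSaito2020EmbeddedSequenceB`: `y^d + A₀`, `d = p^e > 2`, `ord A₀ > d` is a singular
surface germ (`isSingular_pureForm`). [OURS · L1 W4.3] -/
theorem stub_wildPurelyInseparableReductionWon_of_CJSB (hCJS : CossartJannsenSaito2020EmbeddedSequenceB.{0}) :
    ∀ (p : ℕ), p.Prime → ∀ (k : Type) [Field k] [CharP k p] [IsAlgClosed k],
      (∀ m : ℕ, m < 3 → ∀ g : MvPowerSeries (Fin m) k,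
        CobordantGame.IsSingular k g → CobordantGame.Won k m g) →
      ∀ (d : ℕ), (∃ e : ℕ, d = p ^ e) → 2 < d →
      (∀ g : MvPowerSeries (Fin 3) k, CobordantGame.IsSingular k g → g.order < d →
        CobordantGame.Won k 3 g) →
      (∀ g : MvPowerSeries (Fin 3) k, CobordantGame.IsSingular k g → g.order = d →
        (∃ c : Fin 3 → k, c ≠ 0 ∧ ∀ v : Fin 3 → k,
          CobordantChart.initEval (fun _ : Fin 3 => 1) (v + c) d g =
            CobordantChart.initEval (fun _ : Fin 3 => 1) v d g) →
        (∀ c₁ c₂ : Fin 3 → k,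
          (∀ v : Fin 3 → k, CobordantChart.initEval (fun _ : Fin 3 => 1) (v + c₁) d g =
            CobordantChart.initEval (fun _ : Fin 3 => 1) v d g) →
          (∀ v : Fin 3 → k, CobordantChart.initEval (fun _ : Fin 3 => 1) (v + c₂) d g =
            CobordantChart.initEval (fun _ : Fin 3 => 1) v d g) →
          ∃ α β : k, (α ≠ 0 ∨ β ≠ 0) ∧ α • c₁ + β • c₂ = 0) →
        CobordantGame.Won k 3 g) →
      (∀ (A₀ : MvPowerSeries (Fin 2) k), (d : ℕ∞) < A₀.order →
        ((∃ (r s : ℕ) (U : MvPowerSeries (Fin 2) k), MvPowerSeries.constantCoeff U ≠ 0 ∧ ¬ (d ∣ r ∧ d ∣ s) ∧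
            A₀ = MvPowerSeries.X (0 : Fin 2) ^ r * MvPowerSeries.X (1 : Fin 2) ^ s * U) ∨
          (∃ (i : Fin 2) (m : ℕ) (g : MvPowerSeries (Fin 2) k), 0 < m ∧ 0 < g.order ∧ g.order < d ∧
            A₀ = MvPowerSeries.X i ^ (d * m) * g)) →
        CobordantGame.Won k 3 (MvPowerSeries.X (Fin.last 2) ^ d +
          MvPowerSeries.rename (Fin.succAboveEmb (Fin.last 2)) A₀)) →
      ∀ (A₀ : MvPowerSeries (Fin 2) k), (d : ℕ∞) < A₀.order →
        CobordantGame.Won k 3 (MvPowerSeries.X (Fin.last 2) ^ d +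
          MvPowerSeries.rename (Fin.succAboveEmb (Fin.last 2)) A₀) := by
  intro p hp k _ _ _ _ d _ hd2 _ _ _ A₀ hA₀
  exact surfaceGermsWon_of_CJSSequenceB hCJS p hp k _ (isSingular_pureForm k (by omega) A₀ hA₀.le)

/-- **S3ρ as an instance of Track C modulo F-32bR** — the registered stub `stub_wildMonicSurfaceReductionWon` of skeleton v28 (statement
VERBATIM) follows from `CossartJannsenSaito2020EmbeddedSequenceB`: the monic form `y^d + Σ_{j<d} A_j y^j` with the polyhedron condition
`ord A_j > d - j`, `d > 2`, is a singular surface germ (`WildUnaryConeMonic.isSingular_monicForm`). [OURS · L1 W4.3] -/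
theorem stub_wildMonicSurfaceReductionWon_of_CJSB (hCJS : CossartJannsenSaito2020EmbeddedSequenceB.{0}) :
    ∀ (p : ℕ), p.Prime → ∀ (k : Type) [Field k] [CharP k p] [IsAlgClosed k],
      (∀ m : ℕ, m < 3 → ∀ g : MvPowerSeries (Fin m) k,
        CobordantGame.IsSingular k g → CobordantGame.Won k m g) →
      ∀ (d : ℕ), p ∣ d → 2 < d →
      (∀ g : MvPowerSeries (Fin 3) k, CobordantGame.IsSingular k g → g.order < d →
        CobordantGame.Won k 3 g) →
      (∀ g : MvPowerSeries (Fin 3) k, CobordantGame.IsSingular k g → g.order = d →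
        (∃ c : Fin 3 → k, c ≠ 0 ∧ ∀ v : Fin 3 → k,
          CobordantChart.initEval (fun _ : Fin 3 => 1) (v + c) d g =
            CobordantChart.initEval (fun _ : Fin 3 => 1) v d g) →
        (∀ c₁ c₂ : Fin 3 → k,
          (∀ v : Fin 3 → k, CobordantChart.initEval (fun _ : Fin 3 => 1) (v + c₁) d g =
            CobordantChart.initEval (fun _ : Fin 3 => 1) v d g) →
          (∀ v : Fin 3 → k, CobordantChart.initEval (fun _ : Fin 3 => 1) (v + c₂) d g =
            CobordantChart.initEval (fun _ : Fin 3 => 1) v d g) →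
          ∃ α β : k, (α ≠ 0 ∨ β ≠ 0) ∧ α • c₁ + β • c₂ = 0) →
        CobordantGame.Won k 3 g) →
      ((∃ e : ℕ, d = p ^ e) → ∀ (A₀ : MvPowerSeries (Fin 2) k), (d : ℕ∞) < A₀.order →
        CobordantGame.Won k 3 (MvPowerSeries.X (Fin.last 2) ^ d +
          MvPowerSeries.rename (Fin.succAboveEmb (Fin.last 2)) A₀)) →
      ∀ A : Fin d → MvPowerSeries (Fin 2) k, (∀ j : Fin d, ((d - (j : ℕ) : ℕ) : ℕ∞) < (A j).order) →
        CobordantGame.Won k 3 (MvPowerSeries.X (Fin.last 2) ^ d +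
          ∑ j : Fin d, MvPowerSeries.rename (Fin.succAboveEmb (Fin.last 2)) (A j) * MvPowerSeries.X (Fin.last 2) ^ (j : ℕ)) := by
  intro p hp k _ _ _ _ d _ hd2 _ _ _ A hA
  exact surfaceGermsWon_of_CJSSequenceB hCJS p hp k _
    (WildUnaryConeMonic.isSingular_monicForm (k := k) (m := 2) (by omega) A hA)

end Summit.ResolutionOfSingularities.ResolutionOfSingularities.Theorems.TrackC

end
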